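import Summits.QuantumFields.YangMills.Theorems.NPointIsotropy.Negative.ModelBlindFalse
import Summits.QuantumFields.YangMills.Theorems.CurvatureBoostCovariance.Negative.Unbundled
import Literature.MathematicalPhysics.QuantumFieldTheory.OSReconstructionNoE1
import Literature.MathematicalPhysics.QuantumFieldTheory.OSLorentzInvariance

/-!
# Line `moving-support-exclusion` — skeleton for crux `PencilRigidity.NPointIsotropy` (stmt-QuantumFields-11686)

Crux (definitionally, `crux_iff`): `∀ G r sch S₁, W1 r sch S₁ → EightFrameRP S₁ → RadialKernel S₁ → PlanarInvariant S₁`.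

IDEA (crux-idea card `moving-support-exclusion`, ideator 1, round 1; evidence note: "band-limited spectral families
cannot move: joint (H,P) spectrum of every orthogonal frame is SO(3)-invariant"). Work in the `e₀` frame of `W₁`
(OS reconstruction without E1, `OSReconstructionNoE1`: `ℋ, Ω, e^{-tH}, U(a⃗)`, joint spectral measures of `(H, P⃗)`).
For a SPATIAL coordinate plane `(μ, ν)` (`μ, ν ≠ 0`) the rotation `Q_θ` fixes `e₀`, preserves `e₀`-time-ordering and
commutes with `Θ`; put `ψ_θ := Ψ(Q_θ · F)` and `ν^θ := (Q_θ⁻¹)_* μ_{ψ_θ}` (its joint spectral measure rotated back). Then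
(i) `supp ν^θ ⊆ Q_θ⁻¹ Σ`, `Σ` = the joint spectrum (closed) — a MOVING support; (ii) the Laplace–Fourier transform
`(t, a⃗) ↦ ν̂^θ(t, a⃗) = 𝔖(Q_θ · (ΘF* ⊗ F_{(t,a⃗)}))` is, in `θ`, a TRIGONOMETRIC POLYNOMIAL in `e^{4iθ}` (band limit of the
complexified rotation angle — the analytic engine shared with the sibling line `entire-complex-angle-bandlimit` — moved
to the plane `(μ, ν)` by hypercubic conjugation). A trigonometric polynomial of measures whose support must lie in a
continuously moving closed set charges only the rotation-invariant core `⋂_φ Q_φ⁻¹ Σ` (where a neighbourhood is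
uncharged for an interval of angles, Vandermonde kills every harmonic, hence it is uncharged for all angles): `Σ` is
`SO(2)_{μν}`-invariant for the three spatial planes, i.e. `SO(3)`-invariant (`stub_spectrumIsotropy`, fed by the abstract
lemma `stub_movingSupportExclusion`). With the planar cones `H ≥ |P_ν|` of the eight frames of each plane `(0, ν)`
(`stub_planarCone`, the sibling crux stmt-9664 in support form) this is the FULL relativistic spectral condition
`H ≥ |P⃗|` in the `e₀` frame (and, by `W(B₄)`, in every axis frame). The covariance engine (`stub_covarianceEngine`, the
bet, hardest) turns spectral condition + radial two-point kernel + sixteen-mirror RP + regularity + band structure into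
invariance of every `𝔖ₙ` on `⁰𝒮`.

DISPROOF USED (`Cruxes/NPointIsotropy/Disproof.lean` v4 and the landed `Theorems/NPointIsotropy/Negative/*`):
* `not_NPointIsotropyModelBlind`, `not_withoutTieAt4` — the Wilson tie (at every order `≥ 4`) is load-bearing: the line
  uses the tie in `stub_tieRegularity`, whose output is EXACTLY the disprover's recommended clause (continuity of
  `𝔖ₙ|⁰𝒮` off the coincidence locus, the hypothesis of `Disproof.NPointIsotropyRegularModelBlind`); every model-blind
  stub below carries `Regular` or is a consequence of statements that do (the junk family `𝔖₄ = J` is not `Regular`).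
* `not_onAllTests` — the conclusion is `PlanarInvariant` on `⁰𝒮` verbatim, never on all of `𝓢`.
* `Triage.not_AngularBandLimit` (`TriageR1K1AngularBandLimitFalse.lean`, junk witness) refutes the band limit WITHOUT a
  regularity clause; `BandLimited` here is claimed only under `Regular` (`stub_angularBandLimit`).
Nothing is proved here except the composition: `npointIsotropy_of_stubs` (the six stub statements ⇒ crux, sorry-free)
and `NPointIsotropy_of : NPointIsotropy` (by name, closed modulo the registered `stub_*`, the only `sorry`s).
-/

noncomputable section

-- Mathlib's `SimplexCategory` instance `Fintype (Fin (x.len + 1))` matches `Fintype (Fin 4)` (tree-known workaround).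
attribute [-instance] SimplexCategory.instFintypeToTypeOrderHomFinHAddNatLenOfNat

namespace Summit.QuantumFields.YangMills.Cruxes.NPointIsotropy.MovingSupportExclusion

open scoped BigOperators SchwartzMap InnerProductSpace
open MeasureTheory Filter Topology
open Literature.MathematicalPhysics.QuantumLattice Literature.MathematicalPhysics.AQFT
  Literature.MathematicalPhysics.QuantumFieldTheory
open Summit.QuantumFields.YangMills.Theorems.NPointIsotropy.Negative (E4)
open Summit.QuantumFields.YangMills.Theorems.CurvatureBoostCovariance.Negative
  (OSPackage Translations Hypercubic EightFrameRP PlanarInvariant Tie Gaps W1)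

/-! ## §0 Vocabulary (definitions only) -/

/-- The radial-kernel hypothesis of the crux (verbatim; identical to the disprover's `Disproof.RadialKernel`). -/
def RadialKernel (S₁ : SchwingerFamily E4) : Prop :=
  ∃ K : E4 → ℝ, ContinuousOn K {x : E4 | x ≠ 0} ∧ (∀ (R : E4 ≃ₗᵢ[ℝ] E4) (x : E4), x ≠ 0 → K (R x) = K x) ∧
    ∀ F : 𝓢((Fin 2 → E4), ℂ), IsOffDiagonal F →
      MeasureTheory.Integrable (fun x : Fin 2 → E4 => (K (x 0 - x 1) : ℂ) * F x) ∧
      S₁ 2 F = ∫ x : Fin 2 → E4, (K (x 0 - x 1) : ℂ) * F x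

/-- The continuum mass-gap clause of `W₁` (the lattice gap is consumed by `stub_tieRegularity` only). -/
def Gap (S₁ : SchwingerFamily E4) : Prop :=
  ∃ Δ : ℝ, 0 < Δ ∧ S₁.toLabelled.HasMassGap Δ

/-- The crux, unbundled (definitional; as in `Disproof.crux_iff`). -/
theorem crux_iff :
    Summit.QuantumFields.YangMills.Theses.PencilRigidity.NPointIsotropy ↔
      ∀ (G : Type) [Group G] [TopologicalSpace G] [IsTopologicalGroup G] [CompactSpace G],
        IsCompactSimpleLieGroup G →
        letI : MeasurableSpace G := borel G
        haveI : BorelSpace G := ⟨rfl⟩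
        ∀ (r : LatticeRep G) (sch : SpeciesScheme (YMSpecies G)) (S₁ : SchwingerFamily E4),
          W1 r sch S₁ → EightFrameRP S₁ → RadialKernel S₁ → PlanarInvariant S₁ :=
  Iff.rfl

/-- **REGULARITY off the coincidence locus** (verbatim the clause of `Disproof.NPointIsotropyRegularModelBlind`, the
disprover's recommended repair): every `𝔖ₙ|⁰𝒮` is integration against a function continuous off the coincidence locus.
Excludes the junk family (`𝔖₄ = J` charges the Lebesgue-null 7-plane family inside `𝔈₄`). -/
def Regular (S₁ : SchwingerFamily E4) : Prop :=
  ∀ n : ℕ, ∃ W : (Fin n → E4) → ℂ, ContinuousOn W (coincidenceLocus n E4)ᶜ ∧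
    ∀ F : 𝓢((Fin n → E4), ℂ), IsOffDiagonal F →
      MeasureTheory.Integrable (fun x => W x * F x) ∧ S₁ n F = ∫ x, W x * F x

/-- The rotation by `θ` of the `(x₀,x₁)`-plane (tree `planeRot`). -/
abbrev rot (θ : ℝ) : E4 ≃ₗᵢ[ℝ] E4 := planeRot (d := 3) 0 θ

/-- **BAND-LIMITED anisotropy**: for every `n` there is a degree `N` (depending on `n` and `S₁` only) such that for EVERY
off-diagonal `F` the rotated correlator `θ ↦ 𝔖ₙ(R_θ · F)` is a trigonometric polynomial in `e^{4iθ}` of degree `≤ N`. -/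
def BandLimited (S₁ : SchwingerFamily E4) : Prop :=
  ∀ n : ℕ, ∃ N : ℕ, ∀ F : 𝓢((Fin n → E4), ℂ), IsOffDiagonal F →
    ∃ c : ℤ → ℂ, ∀ θ : ℝ,
      S₁ n (linActMulti (rot θ) F) =
        ∑ k ∈ Finset.Icc (-(N : ℤ)) N, c k * Complex.exp (4 * (k : ℂ) * (θ : ℂ) * Complex.I)

/-- **MOVING-SUPPORT EXCLUSION** (the lever, abstract form; pure harmonic analysis on momentum space `ℝ⁴`, energy =
coordinate `0`). Data: a continuous one-parameter family `Q θ` of linear isometries fixing the energy coordinate; a closed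
set `Sp`; finite positive measures `μ θ` on `{p₀ ≥ 0}` all carried by `Sp`; and the BAND hypothesis: for every `t ≥ 0` and
spatial `a`, the Laplace–Fourier transform of the rotated-back measure `(Q θ)⁻¹_* (μ θ)` at `(t, a)` is a trigonometric
polynomial in `e^{4iθ}` of degree `≤ N`. Conclusion: every rotated-back measure is carried by EVERY `(Q θ₀)⁻¹ Sp`, i.e.
by the `Q`-invariant core `⋂_θ₀ (Q θ₀)⁻¹ Sp` — "a band-limited spectral family cannot move". (Proof sketch: exponential
polynomials in `E` and Schwartz Fourier transforms in `p⃗` are dense in `C₀`, so `θ ↦ ∫ φ d((Qθ)⁻¹_* μ θ)` is a trigonometric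
polynomial for every `φ ∈ C₀`; if `Q θ₀ q₀ ∉ Sp`, a neighbourhood of `q₀` is uncharged for `θ` near `θ₀`, Vandermonde kills
all its harmonics, so it is uncharged for every `θ`; Lindelöf.) -/
def MovingSupportExclusion : Prop :=
  ∀ (Q : ℝ → (E4 ≃ₗᵢ[ℝ] E4)), Continuous (fun x : ℝ × E4 => Q x.1 x.2) →
    (∀ (θ : ℝ) (p : E4), Q θ p 0 = p 0) →
    ∀ (Sp : Set E4), IsClosed Sp →
    ∀ (N : ℕ) (μ : ℝ → Measure E4), (∀ θ, IsFiniteMeasure (μ θ)) →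
      (∀ θ, μ θ {p | p 0 < 0} = 0) → (∀ θ, μ θ Spᶜ = 0) →
      (∀ t : ℝ, 0 ≤ t → ∀ a : E4, a 0 = 0 → ∃ c : ℤ → ℂ, ∀ θ : ℝ,
        ∫ p, Complex.exp (((-(t * p 0) : ℝ) : ℂ) + ((⟪a, (Q θ).symm p⟫_ℝ : ℝ) : ℂ) * Complex.I) ∂(μ θ) =
          ∑ k ∈ Finset.Icc (-(N : ℤ)) N, c k * Complex.exp (4 * (k : ℂ) * (θ : ℂ) * Complex.I)) →
      ∀ θ₀ θ₁ : ℝ, μ θ₁ {p | Q θ₀ ((Q θ₁).symm p) ∉ Sp} = 0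

/-- **SPATIAL ISOTROPY OF THE ENERGY–MOMENTUM SPECTRUM in the `W₁` frame `e₀`** ("the joint `(H, P⃗)` spectrum of the
orthogonal frame is `SO(3)`-invariant"): an open subset of momentum space uncharged by every joint spectral measure of the
OS reconstruction along `e₀` stays uncharged after every spatial rotation (determinant-one isometry fixing `e₀`). Set-level
(spectrum, not spectral weights). By proper hypercubic invariance the same then holds in every axis frame. -/
def SpectrumIsotropic (S₁ : SchwingerFamily E4) : Prop :=
  ∀ (h : OSReconstructionNoE1 S₁.toLabelled) (U : Set E4), IsOpen U →
    (∀ (ψ : h.Hilbert) (μ : Measure E4), h.IsJointSpectralMeasure ψ μ → μ U = 0) →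
    ∀ (Q : E4 ≃ₗᵢ[ℝ] E4), LinearMap.det (Q.toLinearEquiv : E4 →ₗ[ℝ] E4) = 1 →
      Q (EuclideanSpace.single 0 1) = EuclideanSpace.single 0 1 →
      ∀ (ψ : h.Hilbert) (μ : Measure E4), h.IsJointSpectralMeasure ψ μ → μ (Q '' U) = 0

/-- **PLANAR SPECTRAL CONES in support form** (sibling crux `MirrorModularBoosts.PlanarSpectralCone`, stmt-9664, read on
the joint spectral measures): along `e₀`, every joint spectral measure of `(H, P⃗)` is carried by `{p₀ ≥ |p_ν|}` for each
spatial direction `ν` (RP in the frames `e₀, e_ν, (e₀ ± e_ν)/√2` of the plane `(0, ν)`; `ν = 1` is `EightFrameRP`, `ν = 2, 3`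
its conjugates by proper signed permutations fixing `e₀`). With `SpectrumIsotropic` it upgrades to the forward light cone
`{p₀ ≥ |p⃗|}` (a countable dense set of rotations of the open set `{p₀ < |p₁|}` covers `{p₀ < |p⃗|}`). -/
def PlanarConeSupport (S₁ : SchwingerFamily E4) : Prop :=
  ∀ (h : OSReconstructionNoE1 S₁.toLabelled) (ψ : h.Hilbert) (μ : Measure E4),
    h.IsJointSpectralMeasure ψ μ → ∀ i : Fin 4, i ≠ 0 → μ {p | p 0 < |p i|} = 0

/-! ## §1 The stubs (registered; `sorry` only here) -/

/-- **stub_tieRegularity — USES THE WILSON TIE** (honours `not_NPointIsotropyModelBlind` and `not_withoutTieAt4`: any proof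
must consume the lattice clause; this is the only stub that sees `G, r, sch`). A one-species family tied to the renormalised
`tr F²` strings of Wilson's lattice theory along a scheme with uniform lattice gap, carrying the OS package, translations,
proper hypercubic invariance, both gaps, sixteen-mirror RP and a continuous radial two-point kernel, has ALL its Schwinger
functions on `⁰𝒮` given by functions continuous off the coincidence locus. The `n = 2` case is the route's own crux
`CurvatureKernelBound` minus the bound; degenerate tied families (every `c ≡ 0` scheme: `𝔖ₙ|⁰𝒮 = 0`; `β_k = 0` frequently:
`κⁿ ∫`, cf. `Disproof` §5) satisfy it; a counterexample is a genuine gapped Wilson scaling limit with a singular `n`-point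
function off coincidences — insulated exactly like the crux. Size: XL / open-problem (a property of the limit a UV
construction outputs; Jaffe–Witten fn. 2). Leans on: `Tie`, `HasLatticeMassGap`, OS78 lattice RP, `CurvatureKernelBound`. -/
theorem stub_tieRegularity :
    ∀ (G : Type) [Group G] [TopologicalSpace G] [IsTopologicalGroup G] [CompactSpace G],
      IsCompactSimpleLieGroup G →
      letI : MeasurableSpace G := borel G
      haveI : BorelSpace G := ⟨rfl⟩
      ∀ (r : LatticeRep G) (sch : SpeciesScheme (YMSpecies G)) (S₁ : SchwingerFamily E4),
        W1 r sch S₁ → EightFrameRP S₁ → RadialKernel S₁ → Regular S₁ := by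
  sorry

/-- **stub_angularBandLimit — the analytic engine (shared with line `entire-complex-angle-bandlimit`), REGULAR form.**
OS package (E0' gives the order, hence the type), translations, proper hypercubic invariance (`π/2`-periodicity: the
quarter-turn is a proper signed permutation), RP in the eight planar frames (planar spectral cones in the `e₀`, `e₁` and
diagonal quantisations; the complex rotation `R_{β+iχ}` is a real boost of `R_β`, which keeps the planar forward tube
whenever the rotated configuration is orderable in one of the four planar directions; the continuations glue by the
identity theorem; Paley–Wiener–Schwartz for `π/2`-periodic entire functions of exponential type) make `θ ↦ 𝔖ₙ(R_θ · F)` a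
trigonometric polynomial in `e^{4iθ}` for `F` supported in planar-GENERIC configurations; `Regular` (joint continuity of
the density and of the coefficients `c_k = ⨍ e^{-4ikθ} 𝔖ₙ ∘ R_θ`) extends the identity from the dense generic set to every
off-diagonal `F` with the same degree. WITHOUT `Regular` the statement is false (`Triage.not_AngularBandLimit`, junk).
Size: L. Leans on: `PlanarSpectralCone` (stmt-9664, open) in multi-slot form, `OSReconstructionNoE1`, `planeRot`/`boostC`
(`OSLorentzInvariance`), `FourierLaplaceHolomorphic`, E0'. -/
theorem stub_angularBandLimit :
    ∀ S₁ : SchwingerFamily E4, OSPackage S₁ → Translations S₁ → Hypercubic S₁ →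
      EightFrameRP S₁ → Regular S₁ → BandLimited S₁ := by
  sorry

/-- **stub_movingSupportExclusion — THE LEVER, abstract** ("band-limited spectral families cannot move"; see
`MovingSupportExclusion`). Provable now; size M (Stone–Weierstrass for `e^{-tE}` on `[0,∞)`, Schwartz Fourier density on
`ℝ³`, uniform limits of trigonometric polynomials of bounded degree, Vandermonde on an interval, Lindelöf). Leans on:
Mathlib measure theory / Fourier analysis only. -/
theorem stub_movingSupportExclusion :
    ∀ (Q : ℝ → (E4 ≃ₗᵢ[ℝ] E4)), Continuous (fun x : ℝ × E4 => Q x.1 x.2) →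
      (∀ (θ : ℝ) (p : E4), Q θ p 0 = p 0) →
      ∀ (Sp : Set E4), IsClosed Sp →
      ∀ (N : ℕ) (μ : ℝ → Measure E4), (∀ θ, IsFiniteMeasure (μ θ)) →
        (∀ θ, μ θ {p | p 0 < 0} = 0) → (∀ θ, μ θ Spᶜ = 0) →
        (∀ t : ℝ, 0 ≤ t → ∀ a : E4, a 0 = 0 → ∃ c : ℤ → ℂ, ∀ θ : ℝ,
          ∫ p, Complex.exp (((-(t * p 0) : ℝ) : ℂ) + ((⟪a, (Q θ).symm p⟫_ℝ : ℝ) : ℂ) * Complex.I) ∂(μ θ) =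
            ∑ k ∈ Finset.Icc (-(N : ℤ)) N, c k * Complex.exp (4 * (k : ℂ) * (θ : ℂ) * Complex.I)) →
        ∀ θ₀ θ₁ : ℝ, μ θ₁ {p | Q θ₀ ((Q θ₁).symm p) ∉ Sp} = 0 := by
  sorry

/-- The registered lever IS the abstract statement `MovingSupportExclusion` (definitional). -/
theorem movingSupportExclusion_of_stub
    (h : ∀ (Q : ℝ → (E4 ≃ₗᵢ[ℝ] E4)), Continuous (fun x : ℝ × E4 => Q x.1 x.2) →
      (∀ (θ : ℝ) (p : E4), Q θ p 0 = p 0) →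
      ∀ (Sp : Set E4), IsClosed Sp →
      ∀ (N : ℕ) (μ : ℝ → Measure E4), (∀ θ, IsFiniteMeasure (μ θ)) →
        (∀ θ, μ θ {p | p 0 < 0} = 0) → (∀ θ, μ θ Spᶜ = 0) →
        (∀ t : ℝ, 0 ≤ t → ∀ a : E4, a 0 = 0 → ∃ c : ℤ → ℂ, ∀ θ : ℝ,
          ∫ p, Complex.exp (((-(t * p 0) : ℝ) : ℂ) + ((⟪a, (Q θ).symm p⟫_ℝ : ℝ) : ℂ) * Complex.I) ∂(μ θ) =
            ∑ k ∈ Finset.Icc (-(N : ℤ)) N, c k * Complex.exp (4 * (k : ℂ) * (θ : ℂ) * Complex.I)) →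
        ∀ θ₀ θ₁ : ℝ, μ θ₁ {p | Q θ₀ ((Q θ₁).symm p) ∉ Sp} = 0) :
    MovingSupportExclusion :=
  h

/-- **stub_spectrumIsotropy — the lever applied in the `e₀` frame.** From the OS package and translations,
`h : OSReconstructionNoE1 S₁.toLabelled` exists with joint spectral measures (`exists_isJointSpectralMeasure_holds`); proper
hypercubic invariance moves `BandLimited` from the `(0,1)`-plane to each spatial coordinate plane `(μ,ν)`
(`𝔖(P⁻¹RP · F) = 𝔖(R · (P · F))` on `⁰𝒮`); for a finite combination `v` of time-ordered generators, `Q_θ · v` is again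
time-ordered (`Q_θ e₀ = e₀`) and `⟪Ψ(Q_θ v), e^{-tH} U(Q_θ a⃗) Ψ(Q_θ v)⟫ = osForm` of `Q_θ ·`(tensor witnesses) is band-limited
in `θ`; `MovingSupportExclusion` with `Sp` = the closed support of the joint spectral measure class gives: the measures
of a dense set of vectors charge only the `SO(2)_{μν}`-invariant core, hence (Laplace–Fourier uniqueness of
`IsJointSpectralMeasure`, total-variation continuity `ψ ↦ μ_ψ`, Lindelöf) so does every `μ_ψ`; the three coordinate
`SO(2)`'s generate `SO(3) = {Q : det Q = 1, Q e₀ = e₀}` (Euler angles). Size: M–L. Leans on: `OSReconstructionNoE1`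
(`fieldVec`, `transfer`, `translate`, `IsJointSpectralMeasure`), `stub_movingSupportExclusion`. -/
theorem stub_spectrumIsotropy :
    MovingSupportExclusion →
      ∀ S₁ : SchwingerFamily E4, OSPackage S₁ → Translations S₁ → Hypercubic S₁ →
        BandLimited S₁ → SpectrumIsotropic S₁ := by
  sorry

/-- **stub_planarCone — the planar spectral cones in support form** (= sibling crux `MirrorModularBoosts.PlanarSpectralCone`,
stmt-QuantumFields-9664, open and staffed, read on spectral measures: joint holomorphy of
`(t,b) ↦ ⟪Ψ_F, e^{-tH} e^{ibP_ν} Ψ_F⟫` on `{|Im b| < Re t}` with the Cauchy–Schwarz bound is equivalent, by Paley–Wiener for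
the finite positive measure `μ_{Ψ_F}`, to `μ_{Ψ_F} {p₀ < |p_ν|} = 0`; density of field vectors and closedness of the cone
condition under norm limits give all `ψ`). The diagonal frames `(e₀ ± e_ν)/√2` are load-bearing (two contraction
semigroups along `e₀ ± e_ν` ⇒ `H ± P_ν ≥ 0`); `ν = 2, 3` by conjugating `EightFrameRP` with a proper signed permutation
fixing `e₀`. Size: M–L (shares its core with stmt-9664; a proof of 9664 in operator form closes it). Leans on:
`OSReconstructionNoE1`, `PlanarSpectralCone`, `MirrorModularBoostsPlanarSpectralCone*` partial results in `Theorems/`. -/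
theorem stub_planarCone :
    ∀ S₁ : SchwingerFamily E4, OSPackage S₁ → Translations S₁ → Hypercubic S₁ →
      EightFrameRP S₁ → PlanarConeSupport S₁ := by
  sorry

/-- **stub_covarianceEngine — THE BET (hardest).** In the `e₀` frame the theory now has: (a) the FULL relativistic spectral
condition `supp μ_ψ ⊆ {p₀ ≥ |p⃗|}` (`PlanarConeSupport` + `SpectrumIsotropic`: rotate the open null set `{p₀ < |p₁|}` by a
countable dense set of spatial rotations), hence forward-TUBE holomorphy of the `e₀`-Wightman functions in all spacetime
directions and real-analyticity of `𝔖ₙ` wherever the `e₀`-times are distinct (by `W(B₄)`: wherever the `n`-times are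
distinct for one of the 16 mirror normals — the complement is exactly the junk locus `𝔈ₙ`, where `Regular` takes over);
(b) from `BandLimited` in a spatial plane `(μ,ν)`: the angle-AVERAGED OS form `B₀ = ⨍ ⟪Ψ(Q_θ ·), Ψ(Q_θ ·)⟫ dθ` is positive,
translation-invariant, carries the contraction semigroup, is comparable to the OS form (`‖Ψ F‖² ≤ (2N+1) B₀(F,F) ≤
(2N+1) sup_θ ‖Ψ(Q_θ F)‖²`) and is EXACTLY `Q`-invariant, so its completion `ℋ̄` carries a unitary `SO(2)_{μν}` with
Euclidean-covariant translations and the harmonics `T_k` (`⟪Ψ(Q_θF),Ψ(Q_θG)⟫ = Σ_k e^{4ikθ} B₀(F, T_k G)`, `T_k` bounded,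
commuting with `(H̄, P̄)`, shifting angular momentum by `4k`); (c) `RadialKernel`: `T_k = 0` (`k ≠ 0`) on one-field vectors,
which carry the Källén–Lehmann representation of the full Euclidean group; (d) `Gap`, E4, E3 and RP across the mirrors
`x_μ = 0`, `x_ν = 0`, `x_μ = ± x_ν`. CLAIM: `T_k = 0` for all `k ≠ 0` — the OS inner product equals its rotational average —
i.e. invariance of `𝔖` on `e₀`-split test functions under `SO(2)_{μν}`, hence (`Regular`: no singular part on the walls) on
`⁰𝒮`, hence (conjugation by a proper signed permutation taking `(μ,ν)` to `(0,1)`) `PlanarInvariant`. Candidate closers for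
the claim: modular localisation on `ℋ` with Borchers' half-sided theorem now available in EVERY lightlike direction of the
`e₀` frame (full cone, not only the planar one of `MirrorModularBoosts`); or a Jost–Schroer/edge-of-the-wedge argument on
the full tube using E3 at Euclidean points. This stub is implied by `Disproof.NPointIsotropyRegularModelBlind` (more
hypotheses, same conclusion): no counterexample known, no proof beyond generalised free fields (Gaier–Yngvason 2000) —
the honest open core. Size: XL. Leans on: `OSReconstructionNoE1`, `AQFT.StandardSubspace*`, `HalfSidedModularInclusion`,
`OSLorentzInvariance` (`TubeInvariant`, `boostC`), `BargmannHallWightman*`, Borchers1992, BrunettiGuidoLongo2002. -/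
theorem stub_covarianceEngine :
    ∀ S₁ : SchwingerFamily E4, OSPackage S₁ → Translations S₁ → Hypercubic S₁ → Gap S₁ →
      EightFrameRP S₁ → RadialKernel S₁ → Regular S₁ → BandLimited S₁ →
      SpectrumIsotropic S₁ → PlanarConeSupport S₁ → PlanarInvariant S₁ := by
  sorry

/-! ## §2 The composition (kernel-checked, no `sorry`) -/

/-- **The line as an implication** (sorry-free): the six stub statements, binder for binder, imply the crux. The tie
enters through hypothesis `hA` (`stub_tieRegularity`) only; everything downstream is model-blind but REGULAR. -/
theorem npointIsotropy_of_stubs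
    (hA : ∀ (G : Type) [Group G] [TopologicalSpace G] [IsTopologicalGroup G] [CompactSpace G],
      IsCompactSimpleLieGroup G →
      letI : MeasurableSpace G := borel G
      haveI : BorelSpace G := ⟨rfl⟩
      ∀ (r : LatticeRep G) (sch : SpeciesScheme (YMSpecies G)) (S₁ : SchwingerFamily E4),
        W1 r sch S₁ → EightFrameRP S₁ → RadialKernel S₁ → Regular S₁)
    (hB : ∀ S₁ : SchwingerFamily E4, OSPackage S₁ → Translations S₁ → Hypercubic S₁ →
      EightFrameRP S₁ → Regular S₁ → BandLimited S₁)
    (hC : ∀ (Q : ℝ → (E4 ≃ₗᵢ[ℝ] E4)), Continuous (fun x : ℝ × E4 => Q x.1 x.2) →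
      (∀ (θ : ℝ) (p : E4), Q θ p 0 = p 0) →
      ∀ (Sp : Set E4), IsClosed Sp →
      ∀ (N : ℕ) (μ : ℝ → Measure E4), (∀ θ, IsFiniteMeasure (μ θ)) →
        (∀ θ, μ θ {p | p 0 < 0} = 0) → (∀ θ, μ θ Spᶜ = 0) →
        (∀ t : ℝ, 0 ≤ t → ∀ a : E4, a 0 = 0 → ∃ c : ℤ → ℂ, ∀ θ : ℝ,
          ∫ p, Complex.exp (((-(t * p 0) : ℝ) : ℂ) + ((⟪a, (Q θ).symm p⟫_ℝ : ℝ) : ℂ) * Complex.I) ∂(μ θ) =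
            ∑ k ∈ Finset.Icc (-(N : ℤ)) N, c k * Complex.exp (4 * (k : ℂ) * (θ : ℂ) * Complex.I)) →
        ∀ θ₀ θ₁ : ℝ, μ θ₁ {p | Q θ₀ ((Q θ₁).symm p) ∉ Sp} = 0)
    (hD : MovingSupportExclusion →
      ∀ S₁ : SchwingerFamily E4, OSPackage S₁ → Translations S₁ → Hypercubic S₁ →
        BandLimited S₁ → SpectrumIsotropic S₁)
    (hE : ∀ S₁ : SchwingerFamily E4, OSPackage S₁ → Translations S₁ → Hypercubic S₁ →
      EightFrameRP S₁ → PlanarConeSupport S₁)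
    (hF : ∀ S₁ : SchwingerFamily E4, OSPackage S₁ → Translations S₁ → Hypercubic S₁ → Gap S₁ →
      EightFrameRP S₁ → RadialKernel S₁ → Regular S₁ → BandLimited S₁ →
      SpectrumIsotropic S₁ → PlanarConeSupport S₁ → PlanarInvariant S₁) :
    Summit.QuantumFields.YangMills.Theses.PencilRigidity.NPointIsotropy := by
  rw [crux_iff]
  intro G _ _ _ _ hG r sch S₁ hW h8 hK
  obtain ⟨hTie, hOS, hTr, hHyp, hGaps⟩ := hW
  have hReg : Regular S₁ := hA G hG r sch S₁ ⟨hTie, hOS, hTr, hHyp, hGaps⟩ h8 hK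
  have hBand : BandLimited S₁ := hB S₁ hOS hTr hHyp h8 hReg
  have hIso : SpectrumIsotropic S₁ := hD (movingSupportExclusion_of_stub hC) S₁ hOS hTr hHyp hBand
  have hCone : PlanarConeSupport S₁ := hE S₁ hOS hTr hHyp h8
  have hGap : Gap S₁ := by
    obtain ⟨Δ, hΔ, hgap, -⟩ := hGaps
    exact ⟨Δ, hΔ, hgap⟩
  exact hF S₁ hOS hTr hHyp hGap h8 hK hReg hBand hIso hCone

/-- **`NPointIsotropy_of` — THE CRUX FROM THE LINE, BY NAME**: `PencilRigidity.NPointIsotropy` from the six registered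
stubs and nothing else (closed modulo `stub_*`, the only `sorry`s of this file). -/
theorem NPointIsotropy_of : Summit.QuantumFields.YangMills.Theses.PencilRigidity.NPointIsotropy :=
  npointIsotropy_of_stubs stub_tieRegularity stub_angularBandLimit stub_movingSupportExclusion
    stub_spectrumIsotropy stub_planarCone stub_covarianceEngine

end Summit.QuantumFields.YangMills.Cruxes.NPointIsotropy.MovingSupportExclusion

end
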